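import Summits.KontsevichZagierPeriods.KontsevichZagierPeriods.Theses.HurwitzMicroSectors
import Summits.KontsevichZagierPeriods.KontsevichZagierPeriods.Theorems.HurwitzMicroSectorsNormalFormPrinciplePiBoxTransfer
import Summits.KontsevichZagierPeriods.KontsevichZagierPeriods.Theorems.HurwitzMicroSectorsNormalFormPrincipleVariants2239

/-! TTRL-lite variant V2333 of stmt-KontsevichZagierPeriods-3869

Variant V2333 = `stub_boxRigidity` (the leaf `BoxRigidity` of `NormalFormPrinciple`: two representations
on open unit boxes with integrands of KZ's rational shape `p/q` over `ℚ` and equal values are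
KZ-equivalent) under the JOINT bound `bound_nat:m≤8; bound_nat:m'≤6`. Verdict of the attempt seat:
**open** — this file is the exact-strength certificate, not a proof of the variant. Writing
`BoxVanishing K` for "every box-rational representation of dimension `K` and value `0` is a relation":

* a joint bound `m ≤ j, m' ≤ k` is ONE dimension, `max j k` (the tree's `boxRigidityLe_iff_boxVanishing`,
  file `…Variants2239`: pad both representations by unit intervals to the common box and subtract there,
  the difference having value `0` by soundness, one way; compare with the zero representation on the
  `0`-box the other way), so `V2333 ⟺ BoxVanishing 8` (`stub_boxRigidity_var2333_iff_boxVanishing_eight`),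
  and the variant is CLOSED MODULO that residual (`stub_boxRigidity_var2333_of_boxVanishing_eight`);
* hence the bound `m' ≤ 6` is idle next to `m ≤ 8`: `V2333 ⟺ BoxRigidity for all m, m' ≤ 8`
  (`stub_boxRigidity_var2333_iff_le_eight`) `⟺` the frozen sibling V2331 (`m = 8, m' = 6`,
  `stub_boxRigidity_var2333_iff_var2331`) — all siblings of maximum dimension `8` coincide: Conjecture 1
  of Kontsevich–Zagier for rational integrands on the open unit boxes of dimension `≤ 8` (among these
  periods `π⁸`, `ζ(5)`, `ζ(7)`, `ζ(3)ζ(5)`, all multiple zeta values of weight `≤ 8`, and in dimension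
  `2` Catalan's `G = ∫∫ dx dy/(1+x²y²)`: for every `c : ℚ` the instance "`G = c ⇒ [(0,1)², 1/(1+x₀²x₁²) − c]`
  is a relation", provable today only through `G ∉ ℚ`, which is open);
* `V2333 ⇒ BoxVanishing j` for every `j ≤ 8` (`boxVanishing_le_eight_of_stub_boxRigidity_var2333`);
* conversely `KontsevichZagierPeriods ⇒ parent ⇒ V2333` (`stub_boxRigidity_var2333_of_statement`), so a
  refutation of the variant would refute the Summit for the tree's calculus; `IntegralRep` carries
  `integrableOn` (no junk-value witness) and no invariant of `KZ.relations` finer than `KZ.eval` is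
  known, so the negation is unattackable;
* the two-sided slice `m, m' ≤ 1` of V2333 is a theorem (`boxRigidity_of_le_one`, Baker — already landed
  in this shape as `stub_boxRigidity_var2229_slice_le_one`, file `…Variants2229`, not restated here), and
  `1` is the largest dimension for which it is.
Residual goal: `∀ M : IntegralRep 8, M.domain = box → M.IsRational → M.value = 0 → of M ∈ relations`.
Source: M. Kontsevich, D. Zagier, *Periods* (2001), §1.2 Conjecture 1 and rules 1)–3). Pure proof file,
no definitions. -/

-- `Summit.<Summit>.<Problem>` is the tree's mandated summit-side namespace (CONVENTIONS §2); for this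
-- single-conjunct summit the two coincide, so the duplicate is deliberate.
set_option linter.dupNamespace false

noncomputable section

namespace Summit.KontsevichZagierPeriods.KontsevichZagierPeriods.Theorems

open MeasureTheory Set
open Literature.NumberTheory.Transcendental Literature.NumberTheory.Transcendental.KZ
open Summit.KontsevichZagierPeriods.KontsevichZagierPeriods.Theses.HurwitzMicroSectors
open Summit.KontsevichZagierPeriods.HurwitzMicroSectors.NormalFormPrinciple.PiBox

/-! ## The variant V2333: exactly `BoxVanishing 8` -/

/-- **V2333 ⟺ `BoxVanishing 8`**: the joint bound `m ≤ 8, m' ≤ 6` is the single dimension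
`max 8 6 = 8` (`boxRigidityLe_iff_boxVanishing 8 6`). [cite: KontsevichZagier2001, §1.2 Conjecture 1] -/
theorem stub_boxRigidity_var2333_iff_boxVanishing_eight :
    (∀ (m m' : ℕ) (N : IntegralRep m) (N' : IntegralRep m'), m' ≤ 6 → m ≤ 8 → N.domain = {x | ∀ i, x i ∈ Set.Ioo (0:ℝ) 1} → N.IsRational → N'.domain = {x | ∀ i, x i ∈ Set.Ioo (0:ℝ) 1} → N'.IsRational → N.value = N'.value → Equivalent N N') ↔
    (∀ (M : IntegralRep 8), M.domain = {x | ∀ i, x i ∈ Set.Ioo (0:ℝ) 1} → M.IsRational →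
      M.value = 0 → of M ∈ relations) :=
  boxRigidityLe_iff_boxVanishing 8 6

/-- **V2333 under `BoxVanishing 8` as a hypothesis** (the variant CLOSED MODULO its residual goal,
stated verbatim): this is the exact missing input. [cite: KontsevichZagier2001, §1.2 Conjecture 1] -/
theorem stub_boxRigidity_var2333_of_boxVanishing_eight
    (hvan : ∀ (M : IntegralRep 8), M.domain = {x | ∀ i, x i ∈ Set.Ioo (0:ℝ) 1} → M.IsRational →
      M.value = 0 → of M ∈ relations) :
    ∀ (m m' : ℕ) (N : IntegralRep m) (N' : IntegralRep m'), m' ≤ 6 → m ≤ 8 → N.domain = {x | ∀ i, x i ∈ Set.Ioo (0:ℝ) 1} → N.IsRational → N'.domain = {x | ∀ i, x i ∈ Set.Ioo (0:ℝ) 1} → N'.IsRational → N.value = N'.value → Equivalent N N' :=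
  stub_boxRigidity_var2333_iff_boxVanishing_eight.2 hvan

/-- **The bound `m' ≤ 6` is idle: V2333 ⟺ BoxRigidity for all `m, m' ≤ 8`** (both are
`BoxVanishing 8`). [cite: KontsevichZagier2001, §1.2 Conjecture 1] -/
theorem stub_boxRigidity_var2333_iff_le_eight :
    (∀ (m m' : ℕ) (N : IntegralRep m) (N' : IntegralRep m'), m' ≤ 6 → m ≤ 8 → N.domain = {x | ∀ i, x i ∈ Set.Ioo (0:ℝ) 1} → N.IsRational → N'.domain = {x | ∀ i, x i ∈ Set.Ioo (0:ℝ) 1} → N'.IsRational → N.value = N'.value → Equivalent N N') ↔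
    (∀ (m m' : ℕ) (N : IntegralRep m) (N' : IntegralRep m'), m' ≤ 8 → m ≤ 8 →
      N.domain = {x | ∀ i, x i ∈ Set.Ioo (0:ℝ) 1} → N.IsRational →
      N'.domain = {x | ∀ i, x i ∈ Set.Ioo (0:ℝ) 1} → N'.IsRational →
      N.value = N'.value → Equivalent N N') :=
  stub_boxRigidity_var2333_iff_boxVanishing_eight.trans (boxRigidityLe_iff_boxVanishing 8 8).symm

/-- **V2333 ⟺ the frozen sibling V2331** (`fix_nat:m=8; fix_nat:m'=6`): both are `BoxVanishing 8` —
forward by specialisation; backward, a vanishing box-rational representation on `(0,1)⁸` is compared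
with the zero representation on `(0,1)⁶` (box-rational, value `0`, itself a relation), which gives
`BoxVanishing 8`. So bounding the pair by `(8, 6)` and freezing it to `(8, 6)` give the same fragment
of the leaf. [cite: KontsevichZagier2001, §1.2 Conjecture 1] -/
theorem stub_boxRigidity_var2333_iff_var2331 :
    (∀ (m m' : ℕ) (N : IntegralRep m) (N' : IntegralRep m'), m' ≤ 6 → m ≤ 8 → N.domain = {x | ∀ i, x i ∈ Set.Ioo (0:ℝ) 1} → N.IsRational → N'.domain = {x | ∀ i, x i ∈ Set.Ioo (0:ℝ) 1} → N'.IsRational → N.value = N'.value → Equivalent N N') ↔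
    (∀ (N : IntegralRep 8) (N' : IntegralRep 6), N.domain = {x | ∀ i, x i ∈ Set.Ioo (0:ℝ) 1} →
      N.IsRational → N'.domain = {x | ∀ i, x i ∈ Set.Ioo (0:ℝ) 1} → N'.IsRational →
      N.value = N'.value → Equivalent N N') := by
  refine ⟨fun h N N' => h 8 6 N N' le_rfl le_rfl, fun h => ?_⟩
  rw [stub_boxRigidity_var2333_iff_boxVanishing_eight]
  intro M hMd hMr hv
  -- the zero representation on the `6`-box: box-rational, value `0`, itself a relation
  obtain ⟨Z, hZd, hZi⟩ := exists_zeroRep (isSemialgebraic_box 6)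
  have hZ : of Z ∈ relations := of_mem_relations_of_eqOn_zero Z (by simp [hZi, EqOn])
  have hZv : Z.value = 0 := by simp [IntegralRep.value, hZi]
  have hZr : Z.IsRational := ⟨0, 1, fun x _ => by simp, fun x _ => by simp [hZi]⟩
  have hMZ : of M - of Z ∈ relations := h M Z hMd hMr hZd hZr (by rw [hv, hZv])
  simpa using relations.add_mem hMZ hZ

/-- **V2333 ⇒ `BoxVanishing` in every dimension `j ≤ 8`** (monotonicity along padding,
`boxVanishing_mono`): in particular the dimension-`2` statement containing Catalan's dichotomy and the
dimension-`5` one containing `ζ(5)`'s. [cite: KontsevichZagier2001, §1.2 Conjecture 1] -/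
theorem boxVanishing_le_eight_of_stub_boxRigidity_var2333
    (h : ∀ (m m' : ℕ) (N : IntegralRep m) (N' : IntegralRep m'), m' ≤ 6 → m ≤ 8 → N.domain = {x | ∀ i, x i ∈ Set.Ioo (0:ℝ) 1} → N.IsRational → N'.domain = {x | ∀ i, x i ∈ Set.Ioo (0:ℝ) 1} → N'.IsRational → N.value = N'.value → Equivalent N N')
    {j : ℕ} (hj : j ≤ 8) (N : IntegralRep j) (hNd : N.domain = {x | ∀ i, x i ∈ Set.Ioo (0:ℝ) 1})
    (hNr : N.IsRational) (hv : N.value = 0) : of N ∈ relations :=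
  boxVanishing_mono hj (stub_boxRigidity_var2333_iff_boxVanishing_eight.1 h) N hNd hNr hv

/-! ## From above: the parent leaf and the Summit -/

/-- **The parent leaf ⇒ V2333** (specialisation; the converse is not claimed — the parent is
`BoxVanishing` in ALL dimensions, the variant only in dimension `8`). [cite: KontsevichZagier2001, §1.2 Conjecture 1] -/
theorem stub_boxRigidity_var2333_of_parent
    (h : ∀ (m m' : ℕ) (N : IntegralRep m) (N' : IntegralRep m'), N.domain = {x | ∀ i, x i ∈ Set.Ioo (0:ℝ) 1} → N.IsRational → N'.domain = {x | ∀ i, x i ∈ Set.Ioo (0:ℝ) 1} → N'.IsRational → N.value = N'.value → Equivalent N N') :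
    ∀ (m m' : ℕ) (N : IntegralRep m) (N' : IntegralRep m'), m' ≤ 6 → m ≤ 8 → N.domain = {x | ∀ i, x i ∈ Set.Ioo (0:ℝ) 1} → N.IsRational → N'.domain = {x | ∀ i, x i ∈ Set.Ioo (0:ℝ) 1} → N'.IsRational → N.value = N'.value → Equivalent N N' :=
  fun m m' N N' _ _ => h m m' N N'

/-- **`KontsevichZagierPeriods ⇒ V2333`**: the variant is a special case of Conjecture 1 for the tree's
calculus (`leaves_of_statement`) — so a refutation of the variant would refute the Summit.
[cite: KontsevichZagier2001, §1.2 Conjecture 1] -/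
theorem stub_boxRigidity_var2333_of_statement (h : _root_.KontsevichZagierPeriods) :
    ∀ (m m' : ℕ) (N : IntegralRep m) (N' : IntegralRep m'), m' ≤ 6 → m ≤ 8 → N.domain = {x | ∀ i, x i ∈ Set.Ioo (0:ℝ) 1} → N.IsRational → N'.domain = {x | ∀ i, x i ∈ Set.Ioo (0:ℝ) 1} → N'.IsRational → N.value = N'.value → Equivalent N N' :=
  stub_boxRigidity_var2333_of_parent (leaves_of_statement h).1

end Summit.KontsevichZagierPeriods.KontsevichZagierPeriods.Theorems

end
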